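import Summits.QuantumFields.YangMills.Theorems.FluctuationComparisonRegPrIntLS2BetaGeodesicJensenLift
import HarnessLib

/-!
# S2β · `hFlat` road, brick (ii-c) of UV3-NODE §57.8 — THE PLAQUETTE WORD OF FOUR SMALL `SU(2)` ELEMENTS TO SECOND ORDER in the quaternion chart:
# `dist1 (e^a e^b e^{−c} e^{−d}) = ‖a + b − c − d‖ ± 12τ²` and `‖log X₁ + log X₂ − log X₃ − log X₄‖ ≤ arc (X₁X₂X₃⁻¹X₄⁻¹) + 12τ²`

Cell `ym3-torus` (rung R3 = continuum `SU(2)` Yang–Mills on the three-torus — NOT d = 4, NOT infinite volume, NOT a mass gap, NOT Clay).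
Width seat «width 12» `ym3-torus-px12` (gen 23), FREE px helper on crux `stmt-QuantumFields-20520` (`Theses.UnitScaleTilt.FluctuationComparisonRegPrIntL`),
count-neutral, DEFINITION-FREE.

WHY.  The curvature letter of the geodesic Whitney hat lift (✓`…S2BetaWhitneyHatLift`, companion `…S2BetaWhitneyHatLiftCurvature`) compares a fine plaquette word
`V₁V₂V₃⁻¹V₄⁻¹` of four exponentials `Vᵢ = expPoint aᵢ`, `‖aᵢ‖ ≤ τ`, with the LINEARISED curl `a₁ + a₂ − a₃ − a₄`, and a coarse plaquette word `X₁X₂X₃⁻¹X₄⁻¹` with the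
linearised curl of the logarithms.  Both are the second-order expansion of [Balaban1985Variational] (34) p.283 («`Π_{b⊂∂p} exp iηA′(b) = exp{iηΣ_b A′(b) + ½i²η²Σ[·,·] + …}`»)
truncated after the LINEAR term, with an explicit remainder `12τ²` for `τ ≤ 1∕4` — elementary in the tree's quaternion chart (lit ✓`T4HaarSU2ExpChart.exp_imQuat`:
`exp (ι x) = cos ‖x‖ + sinc ‖x‖ · ι x`), no BCH series needed (the tree's ✓`Literature.Analysis.Calculus.BCHProductLowOrder` is the third-order version in a complex
Banach algebra; this file is the first-order version in `ℍ`, which is what the `hFlat` road's SIZE × SIZE bookkeeping consumes).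

CONTENTS.  §1 `norm_exp_imQuat_sub_one_sub_le` (`‖e^{ιx} − 1 − ιx‖ ≤ ‖x‖²`, `‖x‖ ≤ 1`, from `1 − t²∕2 ≤ cos t` and `t − t³∕6 < sin t ≤ t`), `norm_exp_imQuat_sub_one_le`
(chord `≤` arc); §2 `norm_mul_sub_one_sub_add_le` (two near-identity factors in any normed ring), `fourFactor_poly_le`, ★`norm_su2Quat_plaq4_sub_le`
(`‖su2Quat (e^a e^b (e^c)⁻¹ (e^d)⁻¹) − 1 − ι(a + b − c − d)‖ ≤ 12τ²`), ★`dist1_plaq4_le`, ★`norm_lincurl_le_dist1_add`, ★★`norm_lincurl_logVec_le_arc_add`.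

HONEST SCOPE.  Trigonometric bounds and normed-ring algebra; nothing of Bałaban's analysis is asserted; `hFlat`, TUBE-REG∘, GAP♯∘, S2β, crux 20520 and `YM3TorusSU2` are
NOT proved; no registered stub is closed; the Yang–Mills mass gap is NOT proved.
References: T. Bałaban, CMP **102** (1985) 277–309 [Balaban1985Variational] ((34) p.283); CMP **99** (1985) 75–102 [Balaban1985RegularSpaces] ((1.29) p.81).
-/

set_option autoImplicit false

noncomputable section

namespace Summit.QuantumFields.YangMills.Theorems.FluctuationComparisonRegPrIntLS2BetaSU2FourFactorExpansion

open scoped Real Quaternion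
open NormedSpace
open Literature.MathematicalPhysics.QuantumLattice (su2Quat norm_su2Quat)
open Literature.MathematicalPhysics.QuantumFieldTheory.Balaban1983to89
open T4CubeChartGnomonic (SU2)
open T4HaarSU2ExpChart (imQuat norm_imQuat exp_imQuat expPoint expPoint_zero su2Quat_expPoint)
open T4HaarSU2Translate (su2Quat_mul su2Quat_one)
open T4ExpWindowSmallField (logVec norm_logVec expPoint_logVec dist1_expPoint_le dist1_eq_norm_su2Quat_sub_one)
open Summit.QuantumFields.YangMills.Theorems.FluctuationComparisonRegPrIntLS2BetaGeodesicJensenLift (dist1_le_norm_logVec)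
open Summit.QuantumFields.YangMills.Theorems.FluctuationComparisonRegPrIntLS2BetaDistributedHolonomySU2 (expPoint_add_smul)

/-! ## §1 The exponential of a pure-imaginary quaternion to second order -/

/-- `|sin t − t| ≤ t³∕6 ≤ t²` and `|cos t − 1| ≤ t²∕2` packaged: **`‖exp (ι x) − 1 − ι x‖ ≤ ‖x‖²`** for `‖x‖ ≤ 1`
(`exp (ι x) = cos ‖x‖ + sinc ‖x‖ · ι x`, lit ✓`exp_imQuat`). [folklore] -/
theorem norm_exp_imQuat_sub_one_sub_le {x : EuclideanSpace ℝ (Fin 3)} (hx : ‖x‖ ≤ 1) :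
    ‖exp (imQuat x) - 1 - imQuat x‖ ≤ ‖x‖ ^ 2 := by
  set t := ‖x‖ with ht
  have ht0 : 0 ≤ t := norm_nonneg _
  rw [exp_imQuat]
  have hsplit : ((Real.cos t : ℝ) : ℍ) + Real.sinc t • imQuat x - 1 - imQuat x
      = (((Real.cos t - 1 : ℝ)) : ℍ) + (Real.sinc t - 1) • imQuat x := by
    rw [sub_smul, one_smul]; push_cast; abel
  rw [hsplit]
  have hcos : ‖(((Real.cos t - 1 : ℝ)) : ℍ)‖ ≤ t ^ 2 / 2 := by
    rw [Quaternion.norm_coe, Real.norm_eq_abs, abs_sub_comm, abs_of_nonneg (sub_nonneg.mpr (Real.cos_le_one t))]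
    linarith [Real.one_sub_sq_div_two_le_cos (x := t)]
  have hsin : ‖(Real.sinc t - 1) • imQuat x‖ ≤ t ^ 2 / 2 := by
    rw [norm_smul, norm_imQuat, ← ht, Real.norm_eq_abs]
    rcases eq_or_lt_of_le ht0 with h0 | hpos
    · rw [← h0, mul_zero]; positivity
    · rw [Real.sinc_of_ne_zero hpos.ne', show Real.sin t / t - 1 = (Real.sin t - t) / t by field_simp, abs_div,
        abs_of_pos hpos, div_mul_cancel₀ _ hpos.ne', abs_sub_comm, abs_of_nonneg (sub_nonneg.mpr (Real.sin_le ht0))]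
      have h3 := Real.sin_gt_sub_cube hpos
      have : t ^ 3 ≤ t ^ 2 := by nlinarith
      nlinarith
  calc ‖(((Real.cos t - 1 : ℝ)) : ℍ) + (Real.sinc t - 1) • imQuat x‖ ≤ t ^ 2 / 2 + t ^ 2 / 2 := norm_add_le_of_le hcos hsin
    _ = t ^ 2 := by ring

/-- `‖exp (ι x) − 1‖ ≤ ‖x‖` (the chord is at most the arc). [folklore] -/
theorem norm_exp_imQuat_sub_one_le (x : EuclideanSpace ℝ (Fin 3)) : ‖exp (imQuat x) - 1‖ ≤ ‖x‖ := by
  rw [← su2Quat_expPoint, ← dist1_eq_norm_su2Quat_sub_one]; exact dist1_expPoint_le x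

/-! ## §2 Products of near-identity elements to second order -/

/-- Two factors: `xy − 1 − (a + b) = (x − 1 − a) + (y − 1 − b) + (x − 1)(y − 1)`. [folklore] -/
theorem norm_mul_sub_one_sub_add_le {A : Type*} [NormedRing A] [NormOneClass A] {x y a b : A} {α β ρ ρ' : ℝ}
    (hx : ‖x - 1‖ ≤ α) (hy : ‖y - 1‖ ≤ β) (ha : ‖x - 1 - a‖ ≤ ρ) (hb : ‖y - 1 - b‖ ≤ ρ') :
    ‖x * y - 1 - (a + b)‖ ≤ ρ + ρ' + α * β ∧ ‖x * y - 1‖ ≤ α + β + α * β := by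
  have hα : 0 ≤ α := (norm_nonneg _).trans hx
  constructor
  · have e : x * y - 1 - (a + b) = (x - 1 - a) + (y - 1 - b) + (x - 1) * (y - 1) := by noncomm_ring
    rw [e]
    exact (norm_add_le_of_le (norm_add_le_of_le ha hb) ((norm_mul_le _ _).trans (mul_le_mul hx hy (norm_nonneg _) hα)))
  · have e : x * y - 1 = (x - 1) + (y - 1) + (x - 1) * (y - 1) := by noncomm_ring
    rw [e]
    exact (norm_add_le_of_le (norm_add_le_of_le hx hy) ((norm_mul_le _ _).trans (mul_le_mul hx hy (norm_nonneg _) hα)))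

/-- The bookkeeping polynomial of the four-factor expansion is `≤ 12τ²` for `0 ≤ τ ≤ 1∕4` (`10τ² + 4τ³ + τ⁴`). [folklore] -/
theorem fourFactor_poly_le {τ : ℝ} (h0 : 0 ≤ τ) (h4 : τ ≤ 1 / 4) :
    τ ^ 2 + τ ^ 2 + τ * τ + τ ^ 2 + (τ + τ + τ * τ) * τ + τ ^ 2 + (τ + τ + τ * τ + τ + (τ + τ + τ * τ) * τ) * τ ≤ 12 * τ ^ 2 := by
  have h3 : τ ^ 2 * τ ≤ τ ^ 2 * (1 / 4) := mul_le_mul_of_nonneg_left h4 (sq_nonneg τ)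
  have h4' : τ ^ 2 * τ * τ ≤ τ ^ 2 * (1 / 4) * (1 / 4) :=
    mul_le_mul h3 h4 h0 (mul_nonneg (sq_nonneg τ) (by norm_num))
  nlinarith [sq_nonneg τ]

/-- ★ **THE PLAQUETTE WORD OF FOUR EXPONENTIALS TO SECOND ORDER**: for `‖a‖, ‖b‖, ‖c‖, ‖d‖ ≤ τ ≤ 1∕4`,
`‖su2Quat (e^a · e^b · (e^c)⁻¹ · (e^d)⁻¹) − 1 − ι(a + b − c − d)‖ ≤ 12 τ²` (`e^x = expPoint x`). [cite: Balaban1985Variational, (34) p.283] -/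
theorem norm_su2Quat_plaq4_sub_le {a b c d : EuclideanSpace ℝ (Fin 3)} {τ : ℝ} (ha : ‖a‖ ≤ τ) (hb : ‖b‖ ≤ τ)
    (hc : ‖c‖ ≤ τ) (hd : ‖d‖ ≤ τ) (hτ : τ ≤ 1 / 4) :
    ‖su2Quat (expPoint a * expPoint b * (expPoint c)⁻¹ * (expPoint d)⁻¹) - 1 - imQuat (a + b - c - d)‖ ≤ 12 * τ ^ 2 := by
  have hτ0 : 0 ≤ τ := (norm_nonneg _).trans ha
  have hτ1 : τ ≤ 1 := by linarith
  have hι : imQuat (a + b - c - d) = imQuat a + imQuat b + imQuat (-c) + imQuat (-d) := by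
    rw [map_neg, map_neg, map_sub, map_sub, map_add]; abel
  -- `expPoint (−x) = (expPoint x)⁻¹` (the ray is a one-parameter group; = ✓`OrganTangentAnchorFreeOscillation.expPoint_neg`, not imported to keep this file light)
  have expPoint_neg : ∀ x : EuclideanSpace ℝ (Fin 3), expPoint (-x) = (expPoint x)⁻¹ := fun x => by
    have h := expPoint_add_smul x 1 (-1)
    rw [add_neg_cancel, zero_smul, expPoint_zero, one_smul, neg_one_smul] at h
    exact (eq_inv_of_mul_eq_one_right h.symm)
  rw [← expPoint_neg c, ← expPoint_neg d, su2Quat_mul, su2Quat_mul, su2Quat_mul, su2Quat_expPoint, su2Quat_expPoint,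
    su2Quat_expPoint, su2Quat_expPoint, hι]
  -- one factor: chord ≤ τ, second-order remainder ≤ τ²
  have h1 : ∀ {x : EuclideanSpace ℝ (Fin 3)}, ‖x‖ ≤ τ → ‖exp (imQuat x) - 1‖ ≤ τ ∧ ‖exp (imQuat x) - 1 - imQuat x‖ ≤ τ ^ 2 :=
    fun {x} hx => ⟨(norm_exp_imQuat_sub_one_le x).trans hx,
      (norm_exp_imQuat_sub_one_sub_le (hx.trans hτ1)).trans (pow_le_pow_left₀ (norm_nonneg _) hx 2)⟩
  have hc' : ‖-c‖ ≤ τ := by rwa [norm_neg]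
  have hd' : ‖-d‖ ≤ τ := by rwa [norm_neg]
  obtain ⟨ha1, ha2⟩ := h1 ha; obtain ⟨hb1, hb2⟩ := h1 hb; obtain ⟨hc1, hc2⟩ := h1 hc'; obtain ⟨hd1, hd2⟩ := h1 hd'
  -- two, three, four factors
  obtain ⟨h12, h12'⟩ := norm_mul_sub_one_sub_add_le ha1 hb1 ha2 hb2
  obtain ⟨h123, h123'⟩ := norm_mul_sub_one_sub_add_le h12' hc1 h12 hc2
  obtain ⟨h1234, -⟩ := norm_mul_sub_one_sub_add_le h123' hd1 h123 hd2
  exact h1234.trans (fourFactor_poly_le hτ0 hτ)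

/-- ★ **CHORD FORM**: `dist1 (e^a e^b (e^c)⁻¹ (e^d)⁻¹) ≤ ‖a + b − c − d‖ + 12τ²`. [cite: Balaban1985Variational, (34) p.283] -/
theorem dist1_plaq4_le {a b c d : EuclideanSpace ℝ (Fin 3)} {τ : ℝ} (ha : ‖a‖ ≤ τ) (hb : ‖b‖ ≤ τ)
    (hc : ‖c‖ ≤ τ) (hd : ‖d‖ ≤ τ) (hτ : τ ≤ 1 / 4) :
    dist1 (expPoint a * expPoint b * (expPoint c)⁻¹ * (expPoint d)⁻¹) ≤ ‖a + b - c - d‖ + 12 * τ ^ 2 := by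
  have h := norm_su2Quat_plaq4_sub_le ha hb hc hd hτ
  rw [dist1_eq_norm_su2Quat_sub_one]
  calc ‖su2Quat (expPoint a * expPoint b * (expPoint c)⁻¹ * (expPoint d)⁻¹) - 1‖
      = ‖(su2Quat (expPoint a * expPoint b * (expPoint c)⁻¹ * (expPoint d)⁻¹) - 1 - imQuat (a + b - c - d)) + imQuat (a + b - c - d)‖ := by
        rw [sub_add_cancel]
    _ ≤ 12 * τ ^ 2 + ‖a + b - c - d‖ := norm_add_le_of_le h (norm_imQuat _).le
    _ = ‖a + b - c - d‖ + 12 * τ ^ 2 := add_comm _ _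

/-- ★ **LINEARISED CURL ≤ CHORD + second order**: `‖a + b − c − d‖ ≤ dist1 (e^a e^b (e^c)⁻¹ (e^d)⁻¹) + 12τ²`. [cite: Balaban1985Variational, (34) p.283] -/
theorem norm_lincurl_le_dist1_add {a b c d : EuclideanSpace ℝ (Fin 3)} {τ : ℝ} (ha : ‖a‖ ≤ τ) (hb : ‖b‖ ≤ τ)
    (hc : ‖c‖ ≤ τ) (hd : ‖d‖ ≤ τ) (hτ : τ ≤ 1 / 4) :
    ‖a + b - c - d‖ ≤ dist1 (expPoint a * expPoint b * (expPoint c)⁻¹ * (expPoint d)⁻¹) + 12 * τ ^ 2 := by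
  have h := norm_su2Quat_plaq4_sub_le ha hb hc hd hτ
  rw [dist1_eq_norm_su2Quat_sub_one, ← norm_imQuat (a + b - c - d)]
  calc ‖imQuat (a + b - c - d)‖
      = ‖(su2Quat (expPoint a * expPoint b * (expPoint c)⁻¹ * (expPoint d)⁻¹) - 1) -
          (su2Quat (expPoint a * expPoint b * (expPoint c)⁻¹ * (expPoint d)⁻¹) - 1 - imQuat (a + b - c - d))‖ := by rw [sub_sub_cancel]
    _ ≤ ‖su2Quat (expPoint a * expPoint b * (expPoint c)⁻¹ * (expPoint d)⁻¹) - 1‖ + 12 * τ ^ 2 := norm_sub_le_of_le le_rfl h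

/-- ★★ **THE SAME FOR FOUR GROUP ELEMENTS**: for `X₁, …, X₄ ∈ SU(2)` with arcs `≤ τ ≤ 1∕4`, the linearised curl of their logarithms is within `12τ²` of the
chord — hence of the ARC — of the plaquette word: `‖log X₁ + log X₂ − log X₃ − log X₄‖ ≤ arc (X₁X₂X₃⁻¹X₄⁻¹) + 12τ²`. [cite: Balaban1985Variational, (34) p.283] -/
theorem norm_lincurl_logVec_le_arc_add (X₁ X₂ X₃ X₄ : SU2) {τ : ℝ} (h₁ : ‖logVec (su2Quat X₁)‖ ≤ τ) (h₂ : ‖logVec (su2Quat X₂)‖ ≤ τ)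
    (h₃ : ‖logVec (su2Quat X₃)‖ ≤ τ) (h₄ : ‖logVec (su2Quat X₄)‖ ≤ τ) (hτ : τ ≤ 1 / 4) :
    ‖logVec (su2Quat X₁) + logVec (su2Quat X₂) - logVec (su2Quat X₃) - logVec (su2Quat X₄)‖
      ≤ ‖logVec (su2Quat (X₁ * X₂ * X₃⁻¹ * X₄⁻¹))‖ + 12 * τ ^ 2 := by
  have h := norm_lincurl_le_dist1_add h₁ h₂ h₃ h₄ hτ
  rw [expPoint_logVec, expPoint_logVec, expPoint_logVec, expPoint_logVec] at h
  exact h.trans ((add_le_add_iff_right _).mpr (dist1_le_norm_logVec _))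

end Summit.QuantumFields.YangMills.Theorems.FluctuationComparisonRegPrIntLS2BetaSU2FourFactorExpansion

end
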